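import Mathlib.Analysis.SpecialFunctions.OrdinaryHypergeometric
import Mathlib.Analysis.Calculus.SmoothSeries
import Mathlib.Analysis.Complex.CauchyIntegral
import Literature.Analysis.SpecialFunctions.HypergeometricODE
import HarnessLib

/-!
# Kummer's confluent hypergeometric function `M(a, b, z) = ₁F₁(a; b; z)` as an entire power
# series: radius `⊤`, coefficient recursion, the derivative formula and Kummer's equation

Mathlib has Gauss's `₂F₁` as a formal power series
(`Mathlib/Analysis/SpecialFunctions/OrdinaryHypergeometric.lean`) but no confluent functions.
This file defines, for complex parameters `a b` and a complex variable `z`,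

* `kummerMCoefficient a b n = (a)ₙ / ((b)ₙ n!)` (ascending Pochhammer symbols; the junk value
  `0` from `n = m + 1` on when `b = −m`, `m : ℕ`, under Mathlib's `0⁻¹ = 0`),
  `kummerMSeries a b = Σ αₙ Xⁿ : FormalMultilinearSeries ℂ ℂ ℂ` and
  `kummerM a b z := (kummerMSeries a b).sum z` — **DLMF 13.2.2**,
  `M(a, b, z) = Σₙ (a)ₙ zⁿ / ((b)ₙ n!)`;

and proves

* `kummerMSeries_radius_eq_top` — the series has radius of convergence `⊤` for ALL `a b` (ratio
  of successive coefficients `(a+n)/((b+n)(n+1)) → 0`; terminating / junk-polynomial cases by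
  eventual vanishing), so `kummerM a b` is ENTIRE: `hasFPowerSeriesOnBall_kummerM`,
  `analyticOnNhd_kummerM`, `differentiable_kummerM`, `continuous_kummerM`, and the series
  converges absolutely to it everywhere (`hasSum_coeff_mul_pow`);
* `kummerMCoefficient_succ`, `succ_mul_coeff_succ` (`(n+1) αₙ₊₁(a,b) = (a/b) αₙ(a+1,b+1)`, no
  hypothesis) and the recursion `coeff_succ_rec`: `(n+1)(b+n) αₙ₊₁ = (a+n) αₙ` for `b + n ≠ 0`;
* `hasDerivAt_kummerM` — **DLMF 13.3.15**: `d/dz M(a,b,z) = (a/b) M(a+1,b+1,z)` on all of `ℂ`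
  (termwise differentiation, this seat's generic `Hypergeometric.hasDerivAt_tsum_mul_pow`);
* `ode_of_hasSum` — a power series whose coefficients satisfy the confluent recursion solves
  `z F'' + (b − z) F' − a F = 0`, and **KUMMER's EQUATION, DLMF 13.2.1**, for `M(a,b,·)` when
  `b ∉ −ℕ`: `kummerM_ode` (with the explicit `f' = (a/b) M(a+1,b+1,·)`,
  `f'' = (a/b)((a+1)/(b+1)) M(a+2,b+2,·)`), `kummerM_ode_hasDerivAt` (pointwise `HasDerivAt`
  packaging) and `kummerM_ode_deriv` (in terms of `deriv`, `deriv (deriv ·)`);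
* `kummerM_zero : M(a, b, 0) = 1`.

Why `b ∉ −ℕ` for the equation: for `b = −m` the coefficients are junk `0` beyond `n = m`, and that
polynomial does not solve Kummer's equation in general (DLMF 13.2.3 uses a limit instead). No
hypothesis on `a` (for `a = −k` the series terminates honestly). The Whittaker function `M_{κ,μ}`
over `kummerM` is in `WhittakerM.lean`; the second solution `U(a,b,z)` is not treated here.

References: NIST DLMF §13.2(i), (13.2.1), (13.2.2), (13.3.15) [DLMF]; G. E. Andrews, R. Askey,
R. Roy, *Special Functions* (1999), §4.1 [AndrewsAskeyRoy1999].
-/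

noncomputable section

open FormalMultilinearSeries Filter Metric
open scoped Topology Nat

namespace Literature.Analysis.SpecialFunctions.Confluent

/-! ### A power series with confluent coefficients solves Kummer's equation -/

section PowerSeries

variable {A : ℕ → ℂ}

/-- **Kummer's equation from the coefficient recurrence**: if `(n+1)(n+b) Aₙ₊₁ = (n+a) Aₙ` for
all `n` and `F₀ = Σ Aₙzⁿ`, `F₁ = Σ (n+1)Aₙ₊₁zⁿ`, `F₂ = Σ (n+1)(n+2)Aₙ₊₂zⁿ` (the series and its two
termwise derivatives at `z`), then `z F₂ + (b − z) F₁ − a F₀ = 0`. [cite: DLMF, 13.2.1] -/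
theorem ode_of_hasSum {a b z F₀ F₁ F₂ : ℂ}
    (hrec : ∀ n : ℕ, ((n : ℂ) + 1) * ((n : ℂ) + b) * A (n + 1) = ((n : ℂ) + a) * A n)
    (h₀ : HasSum (fun n : ℕ => A n * z ^ n) F₀)
    (h₁ : HasSum (fun n : ℕ => ((n : ℂ) + 1) * A (n + 1) * z ^ n) F₁)
    (h₂ : HasSum (fun n : ℕ => ((n : ℂ) + 1) * ((n : ℂ) + 2) * A (n + 2) * z ^ n) F₂) :
    z * F₂ + (b - z) * F₁ - a * F₀ = 0 := by
  -- realign `z F₂` and `z F₁` on the powers `z ^ m`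
  set U : ℕ → ℂ := fun m => (m : ℂ) * ((m : ℂ) + 1) * A (m + 1) * z ^ m with hU_def
  set W : ℕ → ℂ := fun m => (m : ℂ) * A m * z ^ m with hW_def
  have hU' : HasSum (fun n => U (n + 1)) (z * F₂) := by
    have e : (fun n : ℕ => U (n + 1)) =
        fun n : ℕ => z * (((n : ℂ) + 1) * ((n : ℂ) + 2) * A (n + 2) * z ^ n) := by
      funext n
      rw [show n + 1 + 1 = n + 2 from rfl]
      simp only [hU_def, Nat.cast_add, Nat.cast_one, pow_succ]
      ring
    rw [e]; exact h₂.mul_left z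
  have hU : HasSum U (z * F₂) := by simpa [hU_def] using (hasSum_nat_add_iff 1).mp hU'
  have hW' : HasSum (fun n => W (n + 1)) (z * F₁) := by
    have e : (fun n : ℕ => W (n + 1)) =
        fun n : ℕ => z * (((n : ℂ) + 1) * A (n + 1) * z ^ n) := by
      funext n
      simp only [hW_def, Nat.cast_add, Nat.cast_one, pow_succ]
      ring
    rw [e]; exact h₁.mul_left z
  have hW : HasSum W (z * F₁) := by simpa [hW_def] using (hasSum_nat_add_iff 1).mp hW'
  have htot := ((hU.add (h₁.mul_left b)).sub hW).sub (h₀.mul_left a)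
  have hzero : (fun m : ℕ => U m + b * (((m : ℂ) + 1) * A (m + 1) * z ^ m) - W m -
      a * (A m * z ^ m)) = fun _ => 0 := by
    funext m
    have := hrec m
    simp only [hU_def, hW_def]
    linear_combination (z ^ m) * this
  rw [hzero] at htot
  have := htot.unique hasSum_zero
  linear_combination this

end PowerSeries

/-! ### The coefficients, the series, the function -/

section Coefficients

/-- The `n`-th coefficient `(a)ₙ / ((b)ₙ n!)` of Kummer's series `M(a, b, z) = Σ αₙ zⁿ`
(ascending Pochhammer symbols; junk `0` when `(b)ₙ = 0`). [cite: DLMF, 13.2.2] -/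
abbrev kummerMCoefficient (a b : ℂ) (n : ℕ) : ℂ :=
  ((n ! : ℂ)⁻¹) * (ascPochhammer ℂ n).eval a * ((ascPochhammer ℂ n).eval b)⁻¹

/-- Kummer's series `Σₙ (a)ₙ zⁿ/((b)ₙ n!)` as a formal power series over `ℂ`.
[cite: DLMF, 13.2.2] -/
def kummerMSeries (a b : ℂ) : FormalMultilinearSeries ℂ ℂ ℂ :=
  ofScalars ℂ (kummerMCoefficient a b)

/-- **Kummer's confluent hypergeometric function**
`M(a, b, z) = ₁F₁(a; b; z) = Σₙ (a)ₙ zⁿ/((b)ₙ n!)`, the sum of `kummerMSeries a b` (an entire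
function of `z`, see `kummerMSeries_radius_eq_top`; for `b = −m`, `m : ℕ`, it is the junk
polynomial obtained by dropping the terms `n > m`). [cite: DLMF, 13.2.2] -/
def kummerM (a b z : ℂ) : ℂ :=
  (kummerMSeries a b).sum z

variable (a b : ℂ)

/-- `M(a, b, z) = Σₙ αₙ zⁿ` as a complex `tsum`. [cite: DLMF, 13.2.2] -/
theorem kummerM_eq_tsum (z : ℂ) :
    kummerM a b z = ∑' n : ℕ, kummerMCoefficient a b n * z ^ n := by
  simp only [kummerM, kummerMSeries, FormalMultilinearSeries.sum, ofScalars_apply_eq, smul_eq_mul]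

/-- The operator norm of the `n`-th term of Kummer's formal series is `‖αₙ‖`. [folklore] -/
theorem norm_kummerMSeries (n : ℕ) :
    ‖kummerMSeries a b n‖ = ‖kummerMCoefficient a b n‖ := by
  rw [kummerMSeries, ofScalars_norm]

/-- `α₀ = 1`. [cite: DLMF, 13.2.2] -/
@[simp] theorem kummerMCoefficient_zero : kummerMCoefficient a b 0 = 1 := by
  simp [kummerMCoefficient]

/-- The ratio of successive coefficients: `αₙ₊₁ = (a+n)/((b+n)(n+1)) · αₙ` (no hypothesis: both
sides are junk `0` together). [cite: DLMF, 13.2.2] -/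
theorem kummerMCoefficient_succ (n : ℕ) :
    kummerMCoefficient a b (n + 1) =
      (a + n) / ((b + n) * ((n : ℂ) + 1)) * kummerMCoefficient a b n := by
  simp only [kummerMCoefficient, ascPochhammer_succ_eval, Nat.factorial_succ, Nat.cast_mul,
    Nat.cast_add, Nat.cast_one, mul_inv, div_eq_mul_inv]
  ring

/-- `αₙ ≠ 0` as long as neither `a` nor `b` is one of `0, −1, …, −(n−1)`. [cite: DLMF, 13.2.2] -/
theorem kummerMCoefficient_ne_zero {a b : ℂ} {n : ℕ}
    (h : ∀ k < n, (k : ℂ) ≠ -a ∧ (k : ℂ) ≠ -b) : kummerMCoefficient a b n ≠ 0 := by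
  have ha : (ascPochhammer ℂ n).eval a ≠ 0 :=
    (ascPochhammer_eval_eq_zero_iff n a).not.2 (by
      push Not; exact fun k hk => (h k hk).1)
  have hb : (ascPochhammer ℂ n).eval b ≠ 0 :=
    (ascPochhammer_eval_eq_zero_iff n b).not.2 (by
      push Not; exact fun k hk => (h k hk).2)
  simp only [kummerMCoefficient]
  exact mul_ne_zero (mul_ne_zero (inv_ne_zero (by exact_mod_cast n.factorial_ne_zero)) ha)
    (inv_ne_zero hb)

/-- If `a = −k` or `b = −k` then `αₙ = 0` for `n > k` (terminating series, resp. junk zero).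
[cite: DLMF, 13.2.2] -/
theorem kummerMCoefficient_eq_zero_of_neg_nat {a b : ℂ} {k n : ℕ}
    (hab : (k : ℂ) = -a ∨ (k : ℂ) = -b) (hk : k < n) : kummerMCoefficient a b n = 0 := by
  rcases hab with h | h
  · simp [kummerMCoefficient, (ascPochhammer_eval_eq_zero_iff n a).2 ⟨k, hk, h⟩]
  · simp [kummerMCoefficient, (ascPochhammer_eval_eq_zero_iff n b).2 ⟨k, hk, h⟩]

/-- **The radius of convergence of Kummer's series is `⊤`** for all complex `a b`: the ratio of
successive coefficients is `(a+n)/((b+n)(n+1)) → 0` (and in the terminating/junk cases the series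
is eventually zero). [cite: DLMF, 13.2.2] -/
theorem kummerMSeries_radius_eq_top : (kummerMSeries a b).radius = ⊤ := by
  by_cases h : ∀ k : ℕ, (k : ℂ) ≠ -a ∧ (k : ℂ) ≠ -b
  · have hne : ∀ n : ℕ, kummerMCoefficient a b n ≠ 0 := fun n =>
      kummerMCoefficient_ne_zero fun k _ => h k
    refine ofScalars_radius_eq_top_of_tendsto ℂ _ (Eventually.of_forall hne) ?_
    have hratio : ∀ n : ℕ, ‖kummerMCoefficient a b n.succ‖ / ‖kummerMCoefficient a b n‖ =
        ‖(a + n) / ((b + n) * ((n : ℂ) + 1))‖ := by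
      intro n
      rw [Nat.succ_eq_add_one, kummerMCoefficient_succ, norm_mul,
        mul_div_assoc, div_self (norm_ne_zero_iff.2 (hne n)), mul_one]
    simp_rw [hratio]
    rw [← norm_zero (E := ℂ)]
    refine Tendsto.norm ?_
    have h1 : Tendsto (fun n : ℕ => (a + 1 * (n : ℂ)) / (b + 1 * (n : ℂ))) atTop (𝓝 (1 / 1)) :=
      tendsto_add_mul_div_add_mul_atTop_nhds a b 1 one_ne_zero
    have h2 : Tendsto (fun n : ℕ => 1 / ((n : ℂ) + 1)) atTop (𝓝 0) :=
      tendsto_one_div_add_atTop_nhds_zero_nat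
    have h12 := h1.mul h2
    rw [mul_zero] at h12
    refine h12.congr fun n => ?_
    simp only [one_mul, div_mul_div_comm, mul_one]
  · push Not at h
    obtain ⟨k, hk⟩ := h
    refine radius_eq_top_of_forall_image_add_eq_zero _ (k + 1) fun m => ?_
    rw [kummerMSeries]
    refine ofScalars_eq_zero_of_scalar_zero ℂ
      (kummerMCoefficient_eq_zero_of_neg_nat (k := k) ?_ (by lia))
    by_cases ha : (k : ℂ) = -a
    exacts [Or.inl ha, Or.inr (hk ha)]

/-- **`M(a, b, ·)` is entire**: Kummer's series represents `kummerM a b` on the ball of radius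
`⊤` about `0`. [cite: DLMF, 13.2.2] -/
theorem hasFPowerSeriesOnBall_kummerM :
    HasFPowerSeriesOnBall (kummerM a b) (kummerMSeries a b) 0 ⊤ := by
  have h := (kummerMSeries a b).hasFPowerSeriesOnBall
    (by rw [kummerMSeries_radius_eq_top]; exact ENNReal.zero_lt_top)
  rw [kummerMSeries_radius_eq_top] at h
  exact h

/-- `M(a, b, ·)` is analytic on all of `ℂ`. [cite: DLMF, 13.2(i)] -/
theorem analyticOnNhd_kummerM : AnalyticOnNhd ℂ (kummerM a b) Set.univ := by
  simpa only [Metric.eball_top] using (hasFPowerSeriesOnBall_kummerM a b).analyticOnNhd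

/-- `M(a, b, ·)` is analytic at every point. [cite: DLMF, 13.2(i)] -/
theorem analyticAt_kummerM (z : ℂ) : AnalyticAt ℂ (kummerM a b) z :=
  analyticOnNhd_kummerM a b z trivial

/-- `M(a, b, ·)` is complex-differentiable on `ℂ` (entire). [cite: DLMF, 13.2(i)] -/
theorem differentiable_kummerM : Differentiable ℂ (kummerM a b) := fun z =>
  (analyticAt_kummerM a b z).differentiableAt

/-- `M(a, b, ·)` is continuous. [cite: DLMF, 13.2(i)] -/
theorem continuous_kummerM : Continuous (kummerM a b) := (differentiable_kummerM a b).continuous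

/-- Absolute convergence on every disc: `Σ ‖αₙ‖ rⁿ < ∞` for `0 ≤ r`. [cite: DLMF, 13.2.2] -/
theorem summable_norm_coeff_mul_pow {r : ℝ} (hr : 0 ≤ r) :
    Summable fun n : ℕ => ‖kummerMCoefficient a b n‖ * r ^ n := by
  lift r to NNReal using hr
  have h : (r : ENNReal) < (kummerMSeries a b).radius := by
    rw [kummerMSeries_radius_eq_top]; exact ENNReal.coe_lt_top
  refine ((kummerMSeries a b).summable_norm_mul_pow h).congr fun n => ?_
  rw [norm_kummerMSeries]

variable {a b}

/-- Kummer's series converges (absolutely) at every `z`. [cite: DLMF, 13.2.2] -/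
theorem summable_coeff_mul_pow (z : ℂ) :
    Summable fun n : ℕ => kummerMCoefficient a b n * z ^ n :=
  .of_norm <| by
    simpa only [norm_mul, norm_pow] using summable_norm_coeff_mul_pow a b (norm_nonneg z)

/-- Kummer's series sums to `M(a, b, z)` at every `z`. [cite: DLMF, 13.2.2] -/
theorem hasSum_coeff_mul_pow (z : ℂ) :
    HasSum (fun n : ℕ => kummerMCoefficient a b n * z ^ n) (kummerM a b z) := by
  rw [kummerM_eq_tsum]
  exact (summable_coeff_mul_pow z).hasSum

variable (a b)

/-- `M(a, b, 0) = 1`. [cite: DLMF, 13.2.13] -/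
@[simp] theorem kummerM_zero : kummerM a b 0 = 1 := by
  have h := hasSum_coeff_mul_pow (a := a) (b := b) 0
  have := hasSum_single (f := fun n : ℕ => kummerMCoefficient a b n * (0 : ℂ) ^ n) 0
    (fun n hn => by simp [hn])
  exact h.unique (by simpa using this)

/-- The coefficient identity behind DLMF 13.3.15:
`(n+1) αₙ₊₁(a,b) = (a/b) αₙ(a+1,b+1)` (no hypothesis: with `b = 0` or `(b+1)ₙ = 0` both sides
vanish under `0⁻¹ = 0`). [cite: DLMF, 13.3.15] -/
theorem succ_mul_coeff_succ (n : ℕ) :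
    ((n : ℂ) + 1) * kummerMCoefficient a b (n + 1) =
      a / b * kummerMCoefficient (a + 1) (b + 1) n := by
  have hn : ((n : ℂ) + 1) * ((n : ℂ) + 1)⁻¹ = 1 := mul_inv_cancel₀ (Nat.cast_add_one_ne_zero n)
  simp only [kummerMCoefficient, ascPochhammer_succ_left, Polynomial.eval_mul,
    Polynomial.eval_X, Polynomial.eval_comp, Polynomial.eval_add, Polynomial.eval_one,
    Nat.factorial_succ, Nat.cast_mul, Nat.cast_add, Nat.cast_one, mul_inv, div_eq_mul_inv]
  linear_combination (a * b⁻¹ * (((n ! : ℕ) : ℂ)⁻¹ *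
    Polynomial.eval (a + 1) (ascPochhammer ℂ n) *
    (Polynomial.eval (b + 1) (ascPochhammer ℂ n))⁻¹)) * hn

/-- **The coefficient recursion** of Kummer's series: `(n+1)(b+n) αₙ₊₁ = (a+n) αₙ` whenever
`b + n ≠ 0`. [cite: DLMF, 13.2.2] -/
theorem coeff_succ_rec (n : ℕ) (hb : b + n ≠ 0) :
    ((n : ℂ) + 1) * (b + n) * kummerMCoefficient a b (n + 1) =
      (a + n) * kummerMCoefficient a b n := by
  rw [kummerMCoefficient_succ]
  field_simp

end Coefficients

/-! ### The derivative formula (DLMF 13.3.15) -/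

section Calculus

variable {a b : ℂ}

/-- The termwise derivative of Kummer's series sums to `(a/b) M(a+1,b+1,z)`:
`Σ (n+1) αₙ₊₁ zⁿ = (a/b) M(a+1, b+1, z)`. [cite: DLMF, 13.3.15] -/
theorem hasSum_succ_coeff (z : ℂ) :
    HasSum (fun n : ℕ => ((n : ℂ) + 1) * kummerMCoefficient a b (n + 1) * z ^ n)
      (a / b * kummerM (a + 1) (b + 1) z) := by
  have h := (hasSum_coeff_mul_pow (a := a + 1) (b := b + 1) z).mul_left (a / b)
  refine h.congr_fun fun n => ?_
  rw [succ_mul_coeff_succ, mul_assoc]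

/-- The second termwise derivative:
`Σ (n+1)(n+2) αₙ₊₂ zⁿ = (a/b)((a+1)/(b+1)) M(a+2, b+2, z)`. [cite: DLMF, 13.3.16] -/
theorem hasSum_succ_succ_coeff (z : ℂ) :
    HasSum (fun n : ℕ => ((n : ℂ) + 1) * ((n : ℂ) + 2) *
        kummerMCoefficient a b (n + 2) * z ^ n)
      (a / b * ((a + 1) / (b + 1) * kummerM (a + 2) (b + 2) z)) := by
  have h := (hasSum_succ_coeff (a := a + 1) (b := b + 1) z).mul_left (a / b)
  rw [show a + 2 = a + 1 + 1 by ring, show b + 2 = b + 1 + 1 by ring]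
  refine h.congr_fun fun n => ?_
  have e := succ_mul_coeff_succ a b (n + 1)
  push_cast at e
  rw [show n + 2 = n + 1 + 1 from rfl]
  linear_combination ((n : ℂ) + 1) * z ^ n * e

/-- **DLMF 13.3.15**: `d/dz M(a,b,z) = (a/b) M(a+1,b+1,z)` for complex parameters, at every `z`
(termwise differentiation of the everywhere-convergent power series). [cite: DLMF, 13.3.15] -/
theorem hasDerivAt_kummerM (z : ℂ) :
    HasDerivAt (kummerM a b) (a / b * kummerM (a + 1) (b + 1) z) z := by
  set r : ℝ := ‖z‖ + 1 with hr_def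
  have hzr : ‖z‖ < r := by rw [hr_def]; exact lt_add_one _
  have hr0 : 0 < r := (norm_nonneg z).trans_lt hzr
  -- the differentiated coefficients are `(a/b)` times those of `M(a+1,b+1,·)`
  have hu : Summable fun n : ℕ =>
      ‖kummerMCoefficient a b (n + 1)‖ * ((n : ℝ) + 1) * r ^ n := by
    have hs := (summable_norm_coeff_mul_pow (a + 1) (b + 1) hr0.le).mul_left ‖a / b‖
    refine hs.congr fun n => ?_
    have e := congrArg (fun w : ℂ => ‖w‖) (succ_mul_coeff_succ a b n)
    have en : ‖((n : ℂ) + 1)‖ = (n : ℝ) + 1 := by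
      rw [show ((n : ℂ) + 1) = ((n + 1 : ℕ) : ℂ) by push_cast; ring, Complex.norm_natCast]
      push_cast; ring
    rw [norm_mul ((n : ℂ) + 1), norm_mul (a / b), en] at e
    rw [← mul_assoc, ← e]
    ring
  have hmain := Hypergeometric.hasDerivAt_tsum_mul_pow hu hzr
  have hfun : (fun w : ℂ => ∑' n : ℕ, kummerMCoefficient a b n * w ^ n) = kummerM a b := by
    funext w; rw [kummerM_eq_tsum]
  rw [hfun] at hmain
  exact hmain.congr_deriv (hasSum_succ_coeff z).tsum_eq

/-- `deriv` form of DLMF 13.3.15. [cite: DLMF, 13.3.15] -/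
theorem deriv_kummerM (z : ℂ) :
    deriv (kummerM a b) z = a / b * kummerM (a + 1) (b + 1) z :=
  (hasDerivAt_kummerM z).deriv

/-- **DLMF 13.3.16** (`n = 2`): `d²/dz² M(a,b,z) = (a(a+1))/(b(b+1)) M(a+2,b+2,z)`, written as
`(a/b)((a+1)/(b+1)) M(a+2,b+2,z)`. [cite: DLMF, 13.3.16] -/
theorem deriv_deriv_kummerM (z : ℂ) :
    deriv (deriv (kummerM a b)) z = a / b * ((a + 1) / (b + 1) * kummerM (a + 2) (b + 2) z) := by
  rw [show deriv (kummerM a b) = fun z => a / b * kummerM (a + 1) (b + 1) z from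
      funext deriv_kummerM, deriv_const_mul _ (differentiable_kummerM _ _ z), deriv_kummerM,
    show a + 1 + 1 = a + 2 by ring, show b + 1 + 1 = b + 2 by ring]

end Calculus

/-! ### Kummer's equation (DLMF 13.2.1) -/

section ODE

variable {a b : ℂ}

/-- **Kummer's equation, DLMF 13.2.1**, for `f = M(a,b,·)` with `b ∉ −ℕ`, at every `z : ℂ`,
written with the derivative formulas `f' = (a/b) M(a+1,b+1,·)`,
`f'' = (a/b)((a+1)/(b+1)) M(a+2,b+2,·)`: `z f'' + (b − z) f' − a f = 0`. [cite: DLMF, 13.2.1] -/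
theorem kummerM_ode (hb : ∀ n : ℕ, b ≠ -n) (z : ℂ) :
    z * (a / b * ((a + 1) / (b + 1) * kummerM (a + 2) (b + 2) z)) +
      (b - z) * (a / b * kummerM (a + 1) (b + 1) z) - a * kummerM a b z = 0 := by
  have hrec : ∀ n : ℕ, ((n : ℂ) + 1) * ((n : ℂ) + b) * kummerMCoefficient a b (n + 1) =
      ((n : ℂ) + a) * kummerMCoefficient a b n := by
    intro n
    have hbn : b + n ≠ 0 := fun h => hb n (by linear_combination h)
    linear_combination coeff_succ_rec a b n hbn
  exact ode_of_hasSum hrec (hasSum_coeff_mul_pow z) (hasSum_succ_coeff z)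
    (hasSum_succ_succ_coeff z)

/-- **DLMF 13.2.1 in pointwise `HasDerivAt` form**: with `f' z = (a/b) M(a+1,b+1,z)` and
`f'' z = (a/b)((a+1)/(b+1)) M(a+2,b+2,z)`, `M(a,b,·)` has derivative `f' z`, `f'` has derivative
`f'' z`, and `z f'' z + (b − z) f' z − a M(a,b,z) = 0` (`b ∉ −ℕ`). [cite: DLMF, 13.2.1] -/
theorem kummerM_ode_hasDerivAt (hb : ∀ n : ℕ, b ≠ -n) (z : ℂ) :
    HasDerivAt (kummerM a b) (a / b * kummerM (a + 1) (b + 1) z) z ∧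
    HasDerivAt (fun w : ℂ => a / b * kummerM (a + 1) (b + 1) w)
      (a / b * ((a + 1) / (b + 1) * kummerM (a + 2) (b + 2) z)) z ∧
    z * (a / b * ((a + 1) / (b + 1) * kummerM (a + 2) (b + 2) z)) +
      (b - z) * (a / b * kummerM (a + 1) (b + 1) z) - a * kummerM a b z = 0 := by
  refine ⟨hasDerivAt_kummerM z, ?_, kummerM_ode hb z⟩
  have h := (hasDerivAt_kummerM (a := a + 1) (b := b + 1) z).const_mul (a / b)
  rw [show a + 1 + 1 = a + 2 by ring, show b + 1 + 1 = b + 2 by ring] at h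
  exact h

/-- **DLMF 13.2.1 with `deriv`**: `z M'' + (b − z) M' − a M = 0` on `ℂ` for `b ∉ −ℕ`, where
`M' = deriv (kummerM a b)`, `M'' = deriv (deriv (kummerM a b))`. [cite: DLMF, 13.2.1] -/
theorem kummerM_ode_deriv (hb : ∀ n : ℕ, b ≠ -n) (z : ℂ) :
    z * deriv (deriv (kummerM a b)) z + (b - z) * deriv (kummerM a b) z -
      a * kummerM a b z = 0 := by
  rw [deriv_deriv_kummerM, deriv_kummerM]
  exact kummerM_ode hb z

end ODE

end Literature.Analysis.SpecialFunctions.Confluent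

end
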